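import Literature.Analysis.FluidPDE.ElgindiPolarEnergy
import Mathlib.MeasureTheory.Function.L2Space
import Mathlib.Analysis.InnerProductSpace.PiL2
import Mathlib.MeasureTheory.Function.ContinuousMapDense
import HarnessLib

/-!
# The energy space of Elgindi's polar elliptic problem: ambient Hilbert space, graph map, energy form
([Elgindi2021] §7, (PolarBSL) with its natural boundary conditions; [ElgindiGhoulMasmoudi2021] §6 (6.1))

Topic `Literature/Analysis/FluidPDE`. Support file (definitions with bodies and proved API, no
named facts) on the proof path of the named fact
`Literature.Analysis.FluidPDE.Elgindi.ElgindiGhoulMasmoudi2021_stabilityCore`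
(`ElgindiStabilityDecomposition.lean`). T. M. Elgindi, Ann. of Math. 194 (2021) =
arXiv:1904.04795, §7 (p. 19 of the held text):

> "`L(Ψ) = −α²R²∂_{RR}Ψ − α(5+α)R∂_RΨ − ∂_{θθ}Ψ + ∂_θ(tan(θ)Ψ) − 6Ψ = F.`
> We couple this equation with the natural boundary conditions on `Ψ`:
> `Ψ(R,0) = Ψ(R,π/2) = 0`, `lim_{R→∞} Ψ(R,θ) = 0`. […] **Proposition 7.1.** […] Then, the unique `L²`
> solution to (PolarBSL) with Dirichlet boundary conditions […] We only establish the a-priori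
> estimate as existence and uniqueness follows from the standard `L^p` theory."

The existence and uniqueness asserted here (and used throughout [ElgindiGhoulMasmoudi2021], where
`Φ = L_α^{−1}(ε)`) is not printed; this file begins its variational proof (Lax–Milgram in the energy
space). Ambient Hilbert space `E⁴ = L²(strip)⁴` (`stripMeasure = volume|strip`); the **graph map**
of a profile `Ψ = cos θχ`: `J(χ) = (Ψ, αR∂_RΨ, ∂_θΨ, tan θΨ) = (cos θχ, αR cos θ∂_Rχ, −sin θχ + cos θ∂_θχ, sin θχ)`;
the **energy form** `B(U,Φ) = ⟨U₁,Φ₁⟩ + (α−5)⟨U₁,Φ₀⟩ + ⟨U₂,Φ₂⟩ − ⟨U₃,Φ₂⟩ − 6⟨U₀,Φ₀⟩`, a bounded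
bilinear form on `E⁴` (`energyForm`), which on graphs is the weak form of `(L(Ψ), Φ)_{L²(dRdθ)}`
(proved in `ElgindiEllipticWeakForm.lean`).
-/

noncomputable section

open MeasureTheory Set Real Filter Function Finset
open _root_.Topology
open scoped ENNReal InnerProductSpace

namespace Literature.Analysis.FluidPDE

namespace Elgindi

/-! ### The ambient Hilbert space -/

/-- Lebesgue measure restricted to the open quarter strip. [folklore] -/
def stripMeasure : Measure (ℝ × ℝ) := volume.restrict strip

/-- The strip measure is finite on compacts. [folklore] -/
instance : IsFiniteMeasureOnCompacts stripMeasure := by unfold stripMeasure; infer_instance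

/-- The strip measure is s-finite. [folklore] -/
instance : SFinite stripMeasure := by unfold stripMeasure; infer_instance

/-- Unfolding `stripMeasure`. [folklore] -/
theorem stripMeasure_def : stripMeasure = volume.restrict strip := rfl

/-- `L²(strip, dR dθ)`. [cite: Elgindi2021, §7.1 Proposition 7.1 ("the unique L² solution") (p. 19 of arXiv:1904.04795)] -/
abbrev L2Strip : Type := Lp ℝ 2 stripMeasure

/-- The ambient Hilbert space `E⁴ = L²(strip)⁴` of the graph `(Ψ, αR∂_RΨ, ∂_θΨ, tan θΨ)`. [folklore] -/
abbrev E4 : Type := PiLp 2 (fun _ : Fin 4 => L2Strip)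

open scoped Classical in
/-- A plane function as an element of `L²(strip)` (zero if it is not square integrable there). [folklore] -/
def toL2 (f : ℝ × ℝ → ℝ) : L2Strip :=
  if h : MemLp f 2 stripMeasure then h.toLp f else 0

/-- `toL2 f = f` a.e. on the strip for `f ∈ L²(strip)`. [folklore] -/
theorem toL2_ae_eq {f : ℝ × ℝ → ℝ} (hf : MemLp f 2 stripMeasure) : (toL2 f : ℝ × ℝ → ℝ) =ᵐ[stripMeasure] f := by
  unfold toL2; rw [dif_pos hf]; exact hf.coeFn_toLp

/-- `toL2 f = f` a.e. on the strip (restricted-measure form). [folklore] -/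
theorem toL2_ae_eq' {f : ℝ × ℝ → ℝ} (hf : MemLp f 2 stripMeasure) : (toL2 f : ℝ × ℝ → ℝ) =ᵐ[volume.restrict strip] f :=
  toL2_ae_eq hf

/-- `toL2 f = hf.toLp f`. [folklore] -/
theorem toL2_eq_toLp {f : ℝ × ℝ → ℝ} (hf : MemLp f 2 stripMeasure) : toL2 f = hf.toLp f := by
  unfold toL2; exact dif_pos hf

/-- Continuous compactly supported plane functions are in `L²(strip)`. [folklore] -/
theorem memLp_strip_of_continuous {f : ℝ × ℝ → ℝ} (hf : Continuous f) (hs : HasCompactSupport f) :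
    MemLp f 2 stripMeasure :=
  hf.memLp_of_hasCompactSupport hs

/-- The inner product of `L²(strip)` as a strip integral. [folklore] -/
theorem inner_L2Strip (f g : L2Strip) : ⟪f, g⟫_ℝ = ∫ p in strip, (f : ℝ × ℝ → ℝ) p * (g : ℝ × ℝ → ℝ) p := by
  rw [MeasureTheory.L2.inner_def]
  show ∫ p, ⟪(f : ℝ × ℝ → ℝ) p, (g : ℝ × ℝ → ℝ) p⟫_ℝ ∂(volume.restrict strip) = _
  congr 1; funext p; simp [mul_comm]

/-- The inner product of two `toL2`'s of square-integrable functions. [folklore] -/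
theorem inner_toL2 {f g : ℝ × ℝ → ℝ} (hf : MemLp f 2 stripMeasure) (hg : MemLp g 2 stripMeasure) :
    ⟪toL2 f, toL2 g⟫_ℝ = ∫ p in strip, f p * g p := by
  rw [inner_L2Strip]
  refine integral_congr_ae ?_
  filter_upwards [toL2_ae_eq' hf, toL2_ae_eq' hg] with p hp1 hp2
  rw [hp1, hp2]

/-- The squared norm of `toL2 f`. [folklore] -/
theorem norm_toL2_sq {f : ℝ × ℝ → ℝ} (hf : MemLp f 2 stripMeasure) : ‖toL2 f‖ ^ 2 = ∫ p in strip, f p ^ 2 := by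
  rw [← real_inner_self_eq_norm_sq, inner_toL2 hf hf]
  congr 1; funext p; ring

/-! ### The graph map of a profile `Ψ = cos θ·χ` -/

/-- The four components `(Ψ, αR∂_RΨ, ∂_θΨ, tan θΨ)` of the graph of `Ψ = cos θχ`, written in `χ`
(`∂_RΨ = cos θ∂_Rχ`, `∂_θΨ = −sin θχ + cos θ∂_θχ`, `tan θΨ = sin θχ`). [cite: Elgindi2021, §7 (PolarBSL) and §7.2 "It actually is convenient to write Ψ = Ψ̄cos(θ)" (p. 19, 21 of arXiv:1904.04795)] -/
def graphFn (α : ℝ) (χ : ℝ → ℝ → ℝ) : Fin 4 → (ℝ × ℝ → ℝ)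
  | 0 => fun p => Real.cos p.2 * χ p.1 p.2
  | 1 => fun p => α * (p.1 * (Real.cos p.2 * dz χ p.1 p.2))
  | 2 => fun p => -Real.sin p.2 * χ p.1 p.2 + Real.cos p.2 * dθ χ p.1 p.2
  | 3 => fun p => Real.sin p.2 * χ p.1 p.2

/-- The graph element `J(χ) ∈ E⁴`. [folklore] -/
def graphElt (α : ℝ) (χ : ℝ → ℝ → ℝ) : E4 := WithLp.toLp 2 fun k => toL2 (graphFn α χ k)

/-- Components of the graph element. [folklore] -/
theorem graphElt_apply (α : ℝ) (χ : ℝ → ℝ → ℝ) (k : Fin 4) : graphElt α χ k = toL2 (graphFn α χ k) := rfl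

section graphRegularity

variable {α : ℝ} {χ : ℝ → ℝ → ℝ} (hχ : ContDiff ℝ 1 (uncurry χ)) (hs : HasCompactSupport (uncurry χ))
include hχ hs

omit hs in
/-- The graph components are continuous. [folklore] -/
theorem continuous_graphFn (k : Fin 4) : Continuous (graphFn α χ k) := by
  have c0 : Continuous fun p : ℝ × ℝ => χ p.1 p.2 := hχ.continuous
  have c1 : Continuous fun p : ℝ × ℝ => dz χ p.1 p.2 := continuous_dz hχ
  have c2 : Continuous fun p : ℝ × ℝ => dθ χ p.1 p.2 := (contDiff_dθ_of_contDiff (n := 0) (by simpa using hχ)).continuous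
  fin_cases k <;> simp only [graphFn] <;> fun_prop

omit hχ in
/-- The graph components are compactly supported. [folklore] -/
theorem hasCompactSupport_graphFn (k : Fin 4) : HasCompactSupport (graphFn α χ k) := by
  have s1 : HasCompactSupport (uncurry (dz χ)) := hasCompactSupport_dz hs
  have s2 : HasCompactSupport (uncurry (dθ χ)) := hasCompactSupport_dθ_of hs
  fin_cases k <;> simp only [graphFn]
  · exact hs.mul_left
  · exact ((s1.mul_left (f := fun p : ℝ × ℝ => Real.cos p.2)).mul_left (f := fun p : ℝ × ℝ => p.1)).mul_left
  · exact (hs.mul_left (f := fun p : ℝ × ℝ => -Real.sin p.2)).add s2.mul_left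
  · exact hs.mul_left

/-- The graph components are in `L²(strip)`. [folklore] -/
theorem memLp_graphFn (k : Fin 4) : MemLp (graphFn α χ k) 2 stripMeasure :=
  memLp_strip_of_continuous (continuous_graphFn hχ k) (hasCompactSupport_graphFn hs k)

/-- Inner products of graph components are strip integrals. [folklore] -/
theorem inner_graphElt (α' : ℝ) {χ' : ℝ → ℝ → ℝ} (hχ' : ContDiff ℝ 1 (uncurry χ')) (hs' : HasCompactSupport (uncurry χ'))
    (k l : Fin 4) :
    ⟪graphElt α χ k, graphElt α' χ' l⟫_ℝ = ∫ p in strip, graphFn α χ k p * graphFn α' χ' l p := by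
  rw [graphElt_apply, graphElt_apply, inner_toL2 (memLp_graphFn hχ hs k) (memLp_graphFn hχ' hs' l)]

end graphRegularity

/-! ### The energy form -/

/-- The raw bilinear expression `⟨U₁,Φ₁⟩ + (α−5)⟨U₁,Φ₀⟩ + ⟨U₂,Φ₂⟩ − ⟨U₃,Φ₂⟩ − 6⟨U₀,Φ₀⟩`. [folklore] -/
def energyFormFun (α : ℝ) (U Φ : E4) : ℝ :=
  ⟪U 1, Φ 1⟫_ℝ + (α - 5) * ⟪U 1, Φ 0⟫_ℝ + ⟪U 2, Φ 2⟫_ℝ - ⟪U 3, Φ 2⟫_ℝ - 6 * ⟪U 0, Φ 0⟫_ℝ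

/-- The raw expression is bounded: `|B(U,Φ)| ≤ (|α−5| + 9)‖U‖‖Φ‖`. [folklore] -/
theorem abs_energyFormFun_le (α : ℝ) (U Φ : E4) : |energyFormFun α U Φ| ≤ (|α - 5| + 9) * (‖U‖ * ‖Φ‖) := by
  have hk : ∀ k l : Fin 4, |⟪U k, Φ l⟫_ℝ| ≤ ‖U‖ * ‖Φ‖ := fun k l =>
    (abs_real_inner_le_norm _ _).trans (mul_le_mul (PiLp.norm_apply_le U k) (PiLp.norm_apply_le Φ l) (norm_nonneg _) (norm_nonneg _))
  unfold energyFormFun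
  have h1 := hk 1 1; have h2 := hk 1 0; have h3 := hk 2 2; have h4 := hk 3 2; have h5 := hk 0 0
  have hP : 0 ≤ ‖U‖ * ‖Φ‖ := by positivity
  calc |⟪U 1, Φ 1⟫_ℝ + (α - 5) * ⟪U 1, Φ 0⟫_ℝ + ⟪U 2, Φ 2⟫_ℝ - ⟪U 3, Φ 2⟫_ℝ - 6 * ⟪U 0, Φ 0⟫_ℝ|
      ≤ |⟪U 1, Φ 1⟫_ℝ| + |α - 5| * |⟪U 1, Φ 0⟫_ℝ| + |⟪U 2, Φ 2⟫_ℝ| + |⟪U 3, Φ 2⟫_ℝ| + 6 * |⟪U 0, Φ 0⟫_ℝ| := by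
        have e : ∀ x : ℝ, |(α - 5) * x| = |α - 5| * |x| := fun x => abs_mul _ _
        have e6 : ∀ x : ℝ, |6 * x| = 6 * |x| := fun x => by rw [abs_mul]; norm_num
        calc _ ≤ |⟪U 1, Φ 1⟫_ℝ + (α - 5) * ⟪U 1, Φ 0⟫_ℝ + ⟪U 2, Φ 2⟫_ℝ - ⟪U 3, Φ 2⟫_ℝ| + |6 * ⟪U 0, Φ 0⟫_ℝ| := abs_sub _ _
          _ ≤ |⟪U 1, Φ 1⟫_ℝ + (α - 5) * ⟪U 1, Φ 0⟫_ℝ + ⟪U 2, Φ 2⟫_ℝ| + |⟪U 3, Φ 2⟫_ℝ| + |6 * ⟪U 0, Φ 0⟫_ℝ| := by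
              gcongr; exact abs_sub _ _
          _ ≤ |⟪U 1, Φ 1⟫_ℝ + (α - 5) * ⟪U 1, Φ 0⟫_ℝ| + |⟪U 2, Φ 2⟫_ℝ| + |⟪U 3, Φ 2⟫_ℝ| + |6 * ⟪U 0, Φ 0⟫_ℝ| := by
              gcongr; exact abs_add_le _ _
          _ ≤ |⟪U 1, Φ 1⟫_ℝ| + |(α - 5) * ⟪U 1, Φ 0⟫_ℝ| + |⟪U 2, Φ 2⟫_ℝ| + |⟪U 3, Φ 2⟫_ℝ| + |6 * ⟪U 0, Φ 0⟫_ℝ| := by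
              gcongr; exact abs_add_le _ _
          _ = _ := by rw [e, e6]
    _ ≤ (‖U‖ * ‖Φ‖) + |α - 5| * (‖U‖ * ‖Φ‖) + (‖U‖ * ‖Φ‖) + (‖U‖ * ‖Φ‖) + 6 * (‖U‖ * ‖Φ‖) := by
        gcongr
    _ = (|α - 5| + 9) * (‖U‖ * ‖Φ‖) := by ring

/-- **The energy form** `B(U,Φ) = ⟨U₁,Φ₁⟩ + (α−5)⟨U₁,Φ₀⟩ + ⟨U₂,Φ₂⟩ − ⟨U₃,Φ₂⟩ − 6⟨U₀,Φ₀⟩` as a bounded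
bilinear form on `E⁴` (the weak form of `(L(Ψ),Φ)_{L²(dRdθ)}` on graphs, `U₁ = αR∂_RΨ`, `U₂ = ∂_θΨ`,
`U₃ = tan θΨ`). [cite: Elgindi2021, §7.1 proof of Proposition 7.1, Step 2 "Multiplying (PolarBSL) by Ψ and integrating" (p. 19 of arXiv:1904.04795)] -/
def energyForm (α : ℝ) : E4 →L[ℝ] E4 →L[ℝ] ℝ :=
  LinearMap.mkContinuous₂
    (LinearMap.mk₂ ℝ (energyFormFun α)
      (fun U U' Φ => by simp only [energyFormFun, PiLp.add_apply, inner_add_left]; ring)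
      (fun c U Φ => by simp only [energyFormFun, PiLp.smul_apply, real_inner_smul_left]; ring)
      (fun U Φ Φ' => by simp only [energyFormFun, PiLp.add_apply, inner_add_right]; ring)
      (fun c U Φ => by simp only [energyFormFun, PiLp.smul_apply, real_inner_smul_right]; ring))
    (|α - 5| + 9)
    (fun U Φ => by
      rw [Real.norm_eq_abs, mul_assoc]
      exact abs_energyFormFun_le α U Φ)

/-- Unfolding the energy form. [folklore] -/
theorem energyForm_apply (α : ℝ) (U Φ : E4) :
    energyForm α U Φ = ⟪U 1, Φ 1⟫_ℝ + (α - 5) * ⟪U 1, Φ 0⟫_ℝ + ⟪U 2, Φ 2⟫_ℝ - ⟪U 3, Φ 2⟫_ℝ - 6 * ⟪U 0, Φ 0⟫_ℝ := rfl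

/-- **The energy form on two graphs, as a strip integral**:
`B(Jχ, Jχ') = ∫∫ [α²R²∂_RΨ∂_RΦ + (α−5)αR∂_RΨ·Φ + ∂_θΨ∂_θΦ − tan θΨ∂_θΦ − 6ΨΦ]` (`Ψ = cos θχ`,
`Φ = cos θχ'`). [folklore] -/
theorem energyForm_graphElt {α : ℝ} {χ χ' : ℝ → ℝ → ℝ} (hχ : ContDiff ℝ 1 (uncurry χ)) (hs : HasCompactSupport (uncurry χ))
    (hχ' : ContDiff ℝ 1 (uncurry χ')) (hs' : HasCompactSupport (uncurry χ')) :
    energyForm α (graphElt α χ) (graphElt α χ') =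
      ∫ p in strip, (graphFn α χ 1 p * graphFn α χ' 1 p + (α - 5) * (graphFn α χ 1 p * graphFn α χ' 0 p) +
        graphFn α χ 2 p * graphFn α χ' 2 p - graphFn α χ 3 p * graphFn α χ' 2 p - 6 * (graphFn α χ 0 p * graphFn α χ' 0 p)) := by
  rw [energyForm_apply, inner_graphElt hχ hs α hχ' hs', inner_graphElt hχ hs α hχ' hs', inner_graphElt hχ hs α hχ' hs',
    inner_graphElt hχ hs α hχ' hs', inner_graphElt hχ hs α hχ' hs']
  -- integrability of the five products
  have ik : ∀ k l : Fin 4, Integrable (fun p => graphFn α χ k p * graphFn α χ' l p) (volume.restrict strip) := fun k l =>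
    (((continuous_graphFn hχ k).mul (continuous_graphFn hχ' l)).integrable_of_hasCompactSupport
      ((hasCompactSupport_graphFn hs' l).mul_left)).integrableOn
  have i11 := ik 1 1; have i10 := ik 1 0; have i22 := ik 2 2; have i32 := ik 3 2; have i00 := ik 0 0
  have k1 : IntegrableOn (fun p => graphFn α χ 1 p * graphFn α χ' 1 p + (α - 5) * (graphFn α χ 1 p * graphFn α χ' 0 p)) strip :=
    i11.add (i10.const_mul _)
  have k2 : IntegrableOn (fun p => graphFn α χ 1 p * graphFn α χ' 1 p + (α - 5) * (graphFn α χ 1 p * graphFn α χ' 0 p) +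
      graphFn α χ 2 p * graphFn α χ' 2 p) strip := k1.add i22
  have k3 : IntegrableOn (fun p => graphFn α χ 1 p * graphFn α χ' 1 p + (α - 5) * (graphFn α χ 1 p * graphFn α χ' 0 p) +
      graphFn α χ 2 p * graphFn α χ' 2 p - graphFn α χ 3 p * graphFn α χ' 2 p) strip := k2.sub i32
  rw [integral_sub k3 (i00.const_mul _), integral_sub k2 i32, integral_add k1 i22, integral_add i11 (i10.const_mul _),
    MeasureTheory.integral_const_mul, MeasureTheory.integral_const_mul]

end Elgindi

end Literature.Analysis.FluidPDE
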